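import Summits.QuantumFields.YangMills.Theorems.BalabanLadderUVSeamRecClassicalResponseColdWallSplit
import Summits.QuantumFields.YangMills.Theorems.BalabanLadderUVSeamRecResponseMomentsPinning
import Summits.QuantumFields.YangMills.Theorems.BalabanLadderUVSeamRecCeilingsResponseMomentsStrongCoupling
import HarnessLib

/-!
# Crux `UVSeamRec` (stmt-QuantumFields-20043), registered line «coldwall_pure»: the Dirichlet rate law (DR) — INCLUDING ITS FEMTO
# TAIL — FOLLOWS from the cold-wall split (CW) and Gaussian domination (GD)

Helper file (`--supports stmt-QuantumFields-20043`) of the LEAD seat `ym-spine-20043-p1` (gen 16).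

THE OBSERVATION (three lines).  Average the registered payment inequality (CW)
`(R⁴/C₁)|kerE^η_{β,(x−R−1,2R+3)}(plane q x) − kerE^𝟙(plane q x)| ≤ A₂ + carrierCl rF C_s 1 β R q x η` (EVERY exterior `η`) against
Wilson's state of a large odd torus `(ℤ/(2L+1))⁴`, `4R+8 ≤ L`: by the torus DLR identity
`⟨kerE^{·}(plane q x)⟩_{2L+1,β} = ⟨plane q x⟩_{2L+1,β}` (`ResponsePinning.torusE_plane_eq_torusE_kerE`) and `|∫f| ≤ ∫|f|`,
`(R⁴/C₁)|⟨plane q x⟩_{2L+1,β} − kerE^𝟙(plane q x)| ≤ A₂ + ⟨carrierCl C_s⟩_{2L+1,β} = A₂ + C_s⁻¹⟨carrierCl 1⟩_{2L+1,β}`,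
and the torus MEAN of the classical carrier is bounded on the window by (GD) at the one-member family (`n = 1`, source `t = 1`:
`carrierCl ≤ 2·exp √carrierCl` pointwise, so `⟨carrierCl 1⟩ ≤ 2e^{m₁+v₁/2}`).  Choosing ONE torus per `β` that holds every admissible cube
(`L(β) := 4⌈ℓ/uRec β⌉ + 8`) and the reference `p q β := ⟨plane q 0⟩_{2L(β)+1,β}` (the cold-wall kernel mean is translation invariant,
`TemperedResponse.kerE_plane_trivialExterior_eq`), this IS tempered-d1's `DirichletRateSU2` — on the WHOLE femto window, tail included:
* `torusE_carrierCl_le_of_emLin` — (EM_lin) [`C`, `β₁`, `ℓ₁`, `m`, `v`] ⇒ `⟨carrierCl C⟩_{2L+1,β} ≤ 2e^{m+v/2}` on its guards (`β ≥ 0`);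
* `abs_torusE_plane_sub_kerE_one_le` — one torus, one cube: (CW at `(β,R,q,x)`) ∧ (`⟨carrierCl 1⟩ ≤ A₃`) ⇒
  `|⟨plane q x⟩_{2L+1,β} − kerE^𝟙(plane q x)| ≤ (C₁/R⁴)(A₂ + A₃/C_s)`;
* `dirichletRate_of_coldWallSplit_of_carrierMean` — (CW) ∧ (a torus MEAN bound for `carrierCl 1` on the window) ⇒ `DirichletRate`, with the torus
  plaquette mean of the big torus as reference; `dirichletRateSU2_of_coldWallSplit_of_gaussianDomination` — **(CW) ∧ (GD) ⇒ (DR)**;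
* `pureSplitClSU2_of_coldWallSplit_of_gaussianDomination`, `responseMomentsOdd6SU2_of_coldWallSplit_of_gaussianDomination` — hence the flag-free
  split and the registered (RM) body from (CW) ∧ (GD) ALONE: in the registered skeleton `Lines/coldwall_pure.lean` (sha 5f91a2d35d830613) the stub
  `stub_dirichletRateFemtoTail` is REDUNDANT given `stub_coldWallSplit ∧ stub_gaussianDomination` (reshape: 4 stubs → 3, same composition).
What this does NOT say: (DR) as an INSTRUMENT row is unchanged (a measured `R⁻²` law would now refute (CW) ∧ (GD) jointly); the mean bound used is far
weaker than (GD) (first moment of the classical carrier, Gaussian-calibrated `E[βR⁴|F̄(centre)|²] = O(1)`).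
HONEST FRAMING: bookkeeping on a CONDITIONAL chain (DLR + Jensen + exponential Chebyshev); (CW), (GD), the floors are OPEN; nothing of E0′, NT or
the gap; YM mass gap NOT proved; not Clay.
-/

set_option autoImplicit false

noncomputable section

open MeasureTheory Filter Topology Finset
open Literature.MathematicalPhysics.QuantumFieldTheory (GaugeConfig LatticeRep)
open Literature.MathematicalPhysics.QuantumLattice
open Summit.QuantumFields.YangMills.Cruxes.OSLegsFromFemtoAndGap.DlrCollarTransfer
open Summit.QuantumFields.YangMills.Cruxes.UVSeamRec.ResponsePinning
  (torusE_mono torusE_const torusE_add' torusE_const_mul' integrable_comp_lift torusE_plane_eq_torusE_kerE)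
open Summit.QuantumFields.YangMills.Cruxes.UVSeamRec.TemperedResponse (continuous_kerE_plane kerE_plane_trivialExterior_eq)
open Summit.QuantumFields.YangMills.Cruxes.UVSeamRec.ResponseMomentsDefs (ResponseMomentsOdd6SU2)

namespace Summit.QuantumFields.YangMills.Cruxes.UVSeamRec.ClassicalResponse

/-! ## §1 Elementary: `u ≤ 2·exp √u`, continuity of the carrier, `|⟨A⟩| ≤ ⟨|A|⟩` -/

section General

variable {G : Type} [Group G] [TopologicalSpace G] [IsTopologicalGroup G] [CompactSpace G]
  [MeasurableSpace G] [BorelSpace G] (r : LatticeRep G)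

/-- `u ≤ 2·exp(√u)` for `u ≥ 0` (from `1 + s + s²/2 ≤ e^s` at `s = √u`). [folklore] -/
theorem le_two_mul_exp_sqrt {u : ℝ} (hu : 0 ≤ u) : u ≤ 2 * Real.exp (Real.sqrt u) := by
  have h1 := Real.quadratic_le_exp_of_nonneg (Real.sqrt_nonneg u)
  rw [Real.sq_sqrt hu] at h1
  nlinarith [Real.sqrt_nonneg u]

omit [BorelSpace G] in
/-- `η ↦ carrierCl(η)` is continuous. [folklore] -/
theorem continuous_carrierCl (C s β : ℝ) (R : ℕ) (q : Fin 4 × Fin 4) (x : Fin 4 → ℤ) :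
    Continuous (carrierCl r C s β R q x) :=
  continuous_const.mul (continuous_classicalResponse (r := r) _ _ q x s)

/-- `|⟨A⟩_{2L+1,β}| ≤ ⟨|A|⟩_{2L+1,β}`. [folklore] -/
theorem abs_torusE_le_torusE_abs (β : ℝ) (L : ℕ) (A : LGConfig 4 G → ℝ) :
    |torusE G r β L A| ≤ torusE G r β L (fun U => |A U|) := by
  unfold torusE
  exact abs_integral_le_integral_abs

end General

/-! ## §2 `SU(2)`, fundamental representation, unit of record -/

section SU2

/-- **(EM_lin) bounds the torus MEAN of the classical carrier**: under `EMLin C β₁ ℓ₁ m v` (`C > 0`), for `β ≥ β₁`, `β ≥ 0`, `1 ≤ R`,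
`R·uRec β ≤ ℓ₁`, `4R+8 ≤ L`, `q.1 < q.2`, every `x`: `⟨carrierCl C 1 β R q x⟩_{2L+1,β} ≤ 2·e^{m + v/2}` (the one-member family, source `t = 1`,
`u ≤ 2e^{√u}`). [folklore] -/
theorem torusE_carrierCl_le_of_emLin {C β₁ ℓ₁ m v : ℝ} (hC : 0 < C) (h : EMLin C β₁ ℓ₁ m v) {β : ℝ} (hβ : β₁ ≤ β)
    (hβ0 : 0 ≤ β) {L R : ℕ} (q : Fin 4 × Fin 4) (x : Fin 4 → ℤ) (hq : q.1 < q.2) (hR : 1 ≤ R)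
    (hRu : (R : ℝ) * Transport.uRec β ≤ ℓ₁) (hRL : 4 * R + 8 ≤ L) :
    torusE (Matrix.specialUnitaryGroup (Fin 2) ℂ) (fundamentalLatticeRep 2) β L
        (carrierCl (fundamentalLatticeRep 2) C 1 β R q x) ≤ 2 * Real.exp (m + v / 2) := by
  have h1 := h β hβ L 1 (fun _ => q) (fun _ => x) R (fun _ => hq) hR hRu hRL
    (fun i j hij => absurd (Subsingleton.elim i j) hij) Finset.univ (fun _ => 1)
  simp only [Finset.univ_unique, Finset.sum_singleton, one_mul, abs_one, one_pow, mul_one] at h1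
  have hc : Continuous (carrierCl (fundamentalLatticeRep 2) C 1 β R q x) :=
    continuous_carrierCl (fundamentalLatticeRep 2) C 1 β R q x
  have hce : Continuous fun U : LGConfig 4 (Matrix.specialUnitaryGroup (Fin 2) ℂ) =>
      Real.exp (Real.sqrt (carrierCl (fundamentalLatticeRep 2) C 1 β R q x U)) :=
    Real.continuous_exp.comp (Real.continuous_sqrt.comp hc)
  calc torusE (Matrix.specialUnitaryGroup (Fin 2) ℂ) (fundamentalLatticeRep 2) β L
        (carrierCl (fundamentalLatticeRep 2) C 1 β R q x)
      ≤ torusE (Matrix.specialUnitaryGroup (Fin 2) ℂ) (fundamentalLatticeRep 2) β L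
          (fun U => 2 * Real.exp (Real.sqrt (carrierCl (fundamentalLatticeRep 2) C 1 β R q x U))) :=
        torusE_mono (fundamentalLatticeRep 2) β L hc (continuous_const.mul hce) fun U =>
          le_two_mul_exp_sqrt (carrierCl_nonneg hC one_pos hβ0 R q x U)
    _ = 2 * torusE (Matrix.specialUnitaryGroup (Fin 2) ℂ) (fundamentalLatticeRep 2) β L
          (fun U => Real.exp (Real.sqrt (carrierCl (fundamentalLatticeRep 2) C 1 β R q x U))) :=
        torusE_const_mul' (fundamentalLatticeRep 2) β L 2 _
    _ ≤ 2 * Real.exp (m + v / 2) := by linarith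

/-- **One torus, one cube: the torus plaquette mean is pinned to the COLD-WALL kernel mean by (CW) and a carrier-mean bound.**
If at `(β, R, q, x)` the cold-wall split holds for every exterior (`(R⁴/C₁)|kerE^η(plane q x) − kerE^𝟙(plane q x)| ≤ A₂ + carrierCl C_s 1 … η`,
`C_s, C₁ > 0`) and `⟨carrierCl 1 1 β R q x⟩_{2L+1,β} ≤ A₃` on an odd torus with `R + 2 ≤ L`, then
`|⟨plane q x⟩_{2L+1,β} − kerE^𝟙(plane q x)| ≤ (C₁/R⁴)(A₂ + A₃/C_s)` (torus DLR + `|∫f| ≤ ∫|f|`). [folklore: Georgii (2011) Thm. 4.17] -/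
theorem abs_torusE_plane_sub_kerE_one_le {C_s C₁ A₂ A₃ β : ℝ} (hCs : 0 < C_s) (hC₁ : 0 < C₁) {R L : ℕ} (hR : 1 ≤ R)
    (hRL : R + 2 ≤ L) (q : Fin 4 × Fin 4) (x : Fin 4 → ℤ)
    (hCW : ∀ η : LGConfig 4 (Matrix.specialUnitaryGroup (Fin 2) ℂ),
      (R : ℝ) ^ 4 / C₁ * |kerE (Matrix.specialUnitaryGroup (Fin 2) ℂ) (fundamentalLatticeRep 2) β (fun k => x k - (R + 1)) (2 * R + 3) η
          (plane (Matrix.specialUnitaryGroup (Fin 2) ℂ) (fundamentalLatticeRep 2) q x) -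
        kerE (Matrix.specialUnitaryGroup (Fin 2) ℂ) (fundamentalLatticeRep 2) β (fun k => x k - (R + 1)) (2 * R + 3) 1
          (plane (Matrix.specialUnitaryGroup (Fin 2) ℂ) (fundamentalLatticeRep 2) q x)| ≤
        A₂ + carrierCl (fundamentalLatticeRep 2) C_s 1 β R q x η)
    (hCM : torusE (Matrix.specialUnitaryGroup (Fin 2) ℂ) (fundamentalLatticeRep 2) β L
      (carrierCl (fundamentalLatticeRep 2) 1 1 β R q x) ≤ A₃) :
    |torusE (Matrix.specialUnitaryGroup (Fin 2) ℂ) (fundamentalLatticeRep 2) β L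
        (plane (Matrix.specialUnitaryGroup (Fin 2) ℂ) (fundamentalLatticeRep 2) q x) -
      kerE (Matrix.specialUnitaryGroup (Fin 2) ℂ) (fundamentalLatticeRep 2) β (fun k => x k - (R + 1)) (2 * R + 3) 1
        (plane (Matrix.specialUnitaryGroup (Fin 2) ℂ) (fundamentalLatticeRep 2) q x)| ≤
      C₁ / (R : ℝ) ^ 4 * (A₂ + A₃ / C_s) := by
  set G₂ := Matrix.specialUnitaryGroup (Fin 2) ℂ
  set rF : LatticeRep G₂ := fundamentalLatticeRep 2
  set k : LGConfig 4 G₂ → ℝ := fun η => kerE G₂ rF β (fun k => x k - (R + 1)) (2 * R + 3) η (plane G₂ rF q x) with hk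
  set k₁ : ℝ := kerE G₂ rF β (fun k => x k - (R + 1)) (2 * R + 3) 1 (plane G₂ rF q x) with hk₁
  have hkc : Continuous k := continuous_kerE_plane rF β _ _ q x
  have hcc : Continuous (carrierCl rF 1 1 β R q x) := continuous_carrierCl rF 1 1 β R q x
  have hR0 : (0 : ℝ) < R := by exact_mod_cast (show 0 < R by omega)
  have hR4 : 0 < (R : ℝ) ^ 4 / C₁ := by positivity
  -- pointwise consequence of (CW): `|k η − k₁| ≤ (C₁/R⁴)(A₂ + C_s⁻¹ carrierCl 1 1 η)`
  have hpt : ∀ η, |k η - k₁| ≤ C₁ / (R : ℝ) ^ 4 * (A₂ + 1 / C_s * carrierCl rF 1 1 β R q x η) := fun η => by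
    have h0 : (R : ℝ) ^ 4 / C₁ * |k η - k₁| ≤ A₂ + carrierCl rF C_s 1 β R q x η := hCW η
    rw [carrierCl_eq_mul rF 1 C_s 1 β one_ne_zero] at h0
    have e : |k η - k₁| = C₁ / (R : ℝ) ^ 4 * ((R : ℝ) ^ 4 / C₁ * |k η - k₁|) := by
      field_simp
    rw [e]
    exact mul_le_mul_of_nonneg_left h0 (by positivity)
  -- torus DLR
  rw [torusE_plane_eq_torusE_kerE rF β q x R L hRL]
  change |torusE G₂ rF β L k - k₁| ≤ _
  have hsub : torusE G₂ rF β L k - k₁ = torusE G₂ rF β L (fun η => k η - k₁) := by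
    rw [show (fun η => k η - k₁) = (fun η => k η + -k₁) from funext fun _ => sub_eq_add_neg _ _,
      torusE_add' rF β L hkc continuous_const, torusE_const]
    ring
  rw [hsub]
  have hbdc : Continuous fun η => C₁ / (R : ℝ) ^ 4 * (A₂ + 1 / C_s * carrierCl rF 1 1 β R q x η) :=
    continuous_const.mul (continuous_const.add (continuous_const.mul hcc))
  calc |torusE G₂ rF β L (fun η => k η - k₁)|
      ≤ torusE G₂ rF β L (fun η => |k η - k₁|) := abs_torusE_le_torusE_abs rF β L _
    _ ≤ torusE G₂ rF β L (fun η => C₁ / (R : ℝ) ^ 4 * (A₂ + 1 / C_s * carrierCl rF 1 1 β R q x η)) :=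
        torusE_mono rF β L (hkc.sub continuous_const).abs hbdc hpt
    _ = C₁ / (R : ℝ) ^ 4 * (A₂ + 1 / C_s * torusE G₂ rF β L (carrierCl rF 1 1 β R q x)) := by
        have hsum : torusE G₂ rF β L (fun η => A₂ + 1 / C_s * carrierCl rF 1 1 β R q x η) =
            A₂ + 1 / C_s * torusE G₂ rF β L (carrierCl rF 1 1 β R q x) := by
          have h := torusE_add' rF β L (A := fun _ => A₂) (B := fun η => 1 / C_s * carrierCl rF 1 1 β R q x η)
            continuous_const (continuous_const.mul hcc)
          rw [torusE_const, torusE_const_mul'] at h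
          exact h
        rw [torusE_const_mul' rF β L, hsum]
    _ ≤ C₁ / (R : ℝ) ^ 4 * (A₂ + A₃ / C_s) := by
        have h1 : 1 / C_s * torusE G₂ rF β L (carrierCl rF 1 1 β R q x) ≤ A₃ / C_s := by
          rw [one_div, ← div_eq_inv_mul]
          exact div_le_div_of_nonneg_right hCM hCs.le
        have h2 : 0 ≤ C₁ / (R : ℝ) ^ 4 := by positivity
        exact mul_le_mul_of_nonneg_left (by linarith) h2

/-- **(CW) ∧ (a torus MEAN bound for the classical carrier on the window) ⇒ (DR)**, with the reference `p q β := ⟨plane q 0⟩` on the torus of half-side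
`L(β) = 4⌈ℓ/uRec β⌉ + 8` holding every admissible cube (`ℓ := min ℓ₂ ℓ₃`).  The mean bound: for `β ≥ β₃`, `1 ≤ R`, `R·uRec β ≤ ℓ₃`, `4R+8 ≤ L`,
`q.1 < q.2`: `⟨carrierCl 1 1 β R q x⟩_{2L+1,β} ≤ A₃`.  Conclusion: `DirichletRate C₁ (A₂ + A₃/C_s) (max β₂ β₃) ℓ p`. [folklore] -/
theorem dirichletRate_of_coldWallSplit_of_carrierMean {C_s C₁ A₂ β₂ ℓ₂ A₃ β₃ ℓ₃ : ℝ} (hCs : 0 < C_s) (hC₁ : 0 < C₁)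
    (hCW : ∀ β : ℝ, β₂ ≤ β → ∀ R : ℕ, 1 ≤ R → (R : ℝ) * Transport.uRec β ≤ ℓ₂ →
      ∀ (q : Fin 4 × Fin 4) (x : Fin 4 → ℤ), q.1 < q.2 → ∀ η : LGConfig 4 (Matrix.specialUnitaryGroup (Fin 2) ℂ),
      (R : ℝ) ^ 4 / C₁ * |kerE (Matrix.specialUnitaryGroup (Fin 2) ℂ) (fundamentalLatticeRep 2) β (fun k => x k - (R + 1)) (2 * R + 3) η
          (plane (Matrix.specialUnitaryGroup (Fin 2) ℂ) (fundamentalLatticeRep 2) q x) -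
        kerE (Matrix.specialUnitaryGroup (Fin 2) ℂ) (fundamentalLatticeRep 2) β (fun k => x k - (R + 1)) (2 * R + 3) 1
          (plane (Matrix.specialUnitaryGroup (Fin 2) ℂ) (fundamentalLatticeRep 2) q x)| ≤
        A₂ + carrierCl (fundamentalLatticeRep 2) C_s 1 β R q x η)
    (hCM : ∀ β : ℝ, β₃ ≤ β → ∀ (L R : ℕ) (q : Fin 4 × Fin 4) (x : Fin 4 → ℤ), q.1 < q.2 → 1 ≤ R →
      (R : ℝ) * Transport.uRec β ≤ ℓ₃ → 4 * R + 8 ≤ L →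
      torusE (Matrix.specialUnitaryGroup (Fin 2) ℂ) (fundamentalLatticeRep 2) β L
        (carrierCl (fundamentalLatticeRep 2) 1 1 β R q x) ≤ A₃) :
    DirichletRate C₁ (A₂ + A₃ / C_s) (max β₂ β₃) (min ℓ₂ ℓ₃) fun q β =>
      torusE (Matrix.specialUnitaryGroup (Fin 2) ℂ) (fundamentalLatticeRep 2) β (4 * ⌈min ℓ₂ ℓ₃ / Transport.uRec β⌉₊ + 8)
        (plane (Matrix.specialUnitaryGroup (Fin 2) ℂ) (fundamentalLatticeRep 2) q 0) := by
  intro β hβ R hR hRu q x hq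
  set G₂ := Matrix.specialUnitaryGroup (Fin 2) ℂ
  set rF : LatticeRep G₂ := fundamentalLatticeRep 2
  set L : ℕ := 4 * ⌈min ℓ₂ ℓ₃ / Transport.uRec β⌉₊ + 8 with hL
  have hβ₂ : β₂ ≤ β := (le_max_left _ _).trans hβ
  have hβ₃ : β₃ ≤ β := (le_max_right _ _).trans hβ
  have hu := Summit.QuantumFields.YangMills.Cruxes.UVSeamRec.UnitTransfer.uRec_pos β
  -- the cube of radius `R + 1` fits: `R ≤ ⌈ℓ/uRec β⌉`
  have hRceil : R ≤ ⌈min ℓ₂ ℓ₃ / Transport.uRec β⌉₊ := by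
    have h1 : (R : ℝ) ≤ min ℓ₂ ℓ₃ / Transport.uRec β := (le_div_iff₀ hu).2 hRu
    exact_mod_cast h1.trans (Nat.le_ceil _)
  have hRL : 4 * R + 8 ≤ L := by rw [hL]; omega
  have hRu₂ : (R : ℝ) * Transport.uRec β ≤ ℓ₂ := hRu.trans (min_le_left _ _)
  have hRu₃ : (R : ℝ) * Transport.uRec β ≤ ℓ₃ := hRu.trans (min_le_right _ _)
  -- at the site `0`
  have key := abs_torusE_plane_sub_kerE_one_le (β := β) hCs hC₁ hR (by omega : R + 2 ≤ L) q 0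
    (hCW β hβ₂ R hR hRu₂ q 0 hq) (hCM β hβ₃ L R q 0 hq hR hRu₃ hRL)
  -- move the cold-wall kernel from `x` to `0` (translation invariance of the trivial-exterior kernel, LEAD g8)
  have htr : kerE G₂ rF β (fun k => x k - (R + 1)) (2 * R + 3) 1 (plane G₂ rF q x) =
      kerE G₂ rF β (fun k => (0 : Fin 4 → ℤ) k - (R + 1)) (2 * R + 3) 1 (plane G₂ rF q 0) :=
    kerE_plane_trivialExterior_eq rF β q x R
  rw [htr, abs_sub_comm]
  have hR0 : (0 : ℝ) < R := by exact_mod_cast (show 0 < R by omega)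
  have hR4 : 0 < (R : ℝ) ^ 4 / C₁ := by positivity
  rw [← le_div_iff₀' hR4]
  have e : (A₂ + A₃ / C_s) / ((R : ℝ) ^ 4 / C₁) = C₁ / (R : ℝ) ^ 4 * (A₂ + A₃ / C_s) := by
    field_simp
  rw [e]
  exact key

/-- **(CW) ∧ (GD) ⇒ (DR)** — tempered-d1's `DirichletRateSU2` (the WHOLE femto window, tail included) from the registered stubs `stub_coldWallSplit`
(sentence verbatim, ∃-constants) and `stub_gaussianDomination : GaussianDominationSU2` of `Lines/coldwall_pure.lean`.  Reference values: the plaquette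
means of one big torus per `β`; tolerance `A₂ + 2e^{m₁+v₁/2}/C_s`; bound `P₀` = the sup of the plane field. [folklore] -/
theorem dirichletRateSU2_of_coldWallSplit_of_gaussianDomination
    (hCW : ∃ (C_s C₁ A₂ β₂ ℓ₂ : ℝ), 0 < C_s ∧ 0 < C₁ ∧ 0 ≤ A₂ ∧ 0 < ℓ₂ ∧
      ∀ β : ℝ, β₂ ≤ β → ∀ R : ℕ, 1 ≤ R → (R : ℝ) * Transport.uRec β ≤ ℓ₂ →
      ∀ (q : Fin 4 × Fin 4) (x : Fin 4 → ℤ), q.1 < q.2 → ∀ η : LGConfig 4 (Matrix.specialUnitaryGroup (Fin 2) ℂ),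
      (R : ℝ) ^ 4 / C₁ * |kerE (Matrix.specialUnitaryGroup (Fin 2) ℂ) (fundamentalLatticeRep 2) β (fun k => x k - (R + 1)) (2 * R + 3) η
          (plane (Matrix.specialUnitaryGroup (Fin 2) ℂ) (fundamentalLatticeRep 2) q x) -
        kerE (Matrix.specialUnitaryGroup (Fin 2) ℂ) (fundamentalLatticeRep 2) β (fun k => x k - (R + 1)) (2 * R + 3) 1
          (plane (Matrix.specialUnitaryGroup (Fin 2) ℂ) (fundamentalLatticeRep 2) q x)| ≤
        A₂ + carrierCl (fundamentalLatticeRep 2) C_s 1 β R q x η)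
    (hGD : GaussianDominationSU2) : DirichletRateSU2 := by
  obtain ⟨C_s, C₁, A₂, β₂, ℓ₂, hCs, hC₁, hA₂, hℓ₂, hCW⟩ := hCW
  obtain ⟨m₁, v₁, β₁, ℓ₁, hℓ₁, hEM⟩ := hGD
  obtain ⟨P₀, hP₀⟩ := exists_abs_plane_le (G := Matrix.specialUnitaryGroup (Fin 2) ℂ) (fundamentalLatticeRep 2)
  -- the carrier-mean bound from (GD), on `β ≥ max β₁ 0`
  have hCM : ∀ β : ℝ, max β₁ 0 ≤ β → ∀ (L R : ℕ) (q : Fin 4 × Fin 4) (x : Fin 4 → ℤ), q.1 < q.2 → 1 ≤ R →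
      (R : ℝ) * Transport.uRec β ≤ ℓ₁ → 4 * R + 8 ≤ L →
      torusE (Matrix.specialUnitaryGroup (Fin 2) ℂ) (fundamentalLatticeRep 2) β L
        (carrierCl (fundamentalLatticeRep 2) 1 1 β R q x) ≤ 2 * Real.exp (m₁ + v₁ / 2) :=
    fun β hβ L R q x hq hR hRu hRL =>
      torusE_carrierCl_le_of_emLin one_pos hEM ((le_max_left _ _).trans hβ) ((le_max_right _ _).trans hβ) q x hq hR hRu hRL
  have hDR := dirichletRate_of_coldWallSplit_of_carrierMean hCs hC₁ hCW hCM
  have hp : ∀ (q : Fin 4 × Fin 4) (β : ℝ),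
      |torusE (Matrix.specialUnitaryGroup (Fin 2) ℂ) (fundamentalLatticeRep 2) β (4 * ⌈min ℓ₂ ℓ₁ / Transport.uRec β⌉₊ + 8)
        (plane (Matrix.specialUnitaryGroup (Fin 2) ℂ) (fundamentalLatticeRep 2) q 0)| ≤ P₀ := fun q β => by
    have h := ResponsePinning.abs_torusE_sub_le_of_forall (fundamentalLatticeRep 2) β
      (4 * ⌈min ℓ₂ ℓ₁ / Transport.uRec β⌉₊ + 8) (continuous_plane (fundamentalLatticeRep 2) q 0) (c := 0) (h := P₀)
      (fun U => by rw [sub_zero]; exact hP₀ q 0 U)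
    rwa [sub_zero] at h
  exact ⟨C₁, A₂ + 2 * Real.exp (m₁ + v₁ / 2) / C_s, P₀, max β₂ (max β₁ 0), min ℓ₂ ℓ₁, _, hC₁, by positivity,
    lt_min hℓ₂ hℓ₁, hp, hDR⟩

/-- **(CW) ∧ (GD) ⇒ the flag-free split `PureSplitClSU2`** (through (DR) just proved and the LEAD g10 triangle
`pureSplitCl_of_dirichletRate_and_coldWallSplit`, after restricting to the common window and rescaling the kernel constant as in the skeleton's
`pureSplitClSU2_of_stubs`). [folklore] -/
theorem pureSplitClSU2_of_coldWallSplit_of_gaussianDomination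
    (hCW : ∃ (C_s C₁ A₂ β₂ ℓ₂ : ℝ), 0 < C_s ∧ 0 < C₁ ∧ 0 ≤ A₂ ∧ 0 < ℓ₂ ∧
      ∀ β : ℝ, β₂ ≤ β → ∀ R : ℕ, 1 ≤ R → (R : ℝ) * Transport.uRec β ≤ ℓ₂ →
      ∀ (q : Fin 4 × Fin 4) (x : Fin 4 → ℤ), q.1 < q.2 → ∀ η : LGConfig 4 (Matrix.specialUnitaryGroup (Fin 2) ℂ),
      (R : ℝ) ^ 4 / C₁ * |kerE (Matrix.specialUnitaryGroup (Fin 2) ℂ) (fundamentalLatticeRep 2) β (fun k => x k - (R + 1)) (2 * R + 3) η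
          (plane (Matrix.specialUnitaryGroup (Fin 2) ℂ) (fundamentalLatticeRep 2) q x) -
        kerE (Matrix.specialUnitaryGroup (Fin 2) ℂ) (fundamentalLatticeRep 2) β (fun k => x k - (R + 1)) (2 * R + 3) 1
          (plane (Matrix.specialUnitaryGroup (Fin 2) ℂ) (fundamentalLatticeRep 2) q x)| ≤
        A₂ + carrierCl (fundamentalLatticeRep 2) C_s 1 β R q x η)
    (hGD : GaussianDominationSU2) : PureSplitClSU2 := by
  have hDR := dirichletRateSU2_of_coldWallSplit_of_gaussianDomination hCW hGD
  obtain ⟨C₁, A₁, P₀, β₁, ℓ₁, p, hC₁, hA₁, hℓ₁, hp, hDR⟩ := hDR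
  obtain ⟨C_s, C₁', A₂, β₂, ℓ₂, hCs, hC₁', hA₂, hℓ₂, hCW⟩ := hCW
  refine ⟨C_s * C₁ / C₁', C₁, A₁ + C₁' / C₁ * A₂, P₀, max β₁ β₂, min ℓ₁ ℓ₂, p, by positivity, hC₁, by positivity,
    lt_min hℓ₁ hℓ₂, hp, ?_⟩
  refine pureSplitCl_of_dirichletRate_and_coldWallSplit hC₁ ?_ ?_
  · intro β hβ R hR hRu q x hq
    exact hDR β ((le_max_left _ _).trans hβ) R hR (hRu.trans (min_le_left _ _)) q x hq
  · intro β hβ R hR hRu q x hq η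
    have h0 := hCW β ((le_max_right _ _).trans hβ) R hR (hRu.trans (min_le_right _ _)) q x hq η
    have hk : 0 ≤ C₁' / C₁ := by positivity
    have h1 := mul_le_mul_of_nonneg_left h0 hk
    have hlhs : C₁' / C₁ * ((R : ℝ) ^ 4 / C₁' *
        |kerE (Matrix.specialUnitaryGroup (Fin 2) ℂ) (fundamentalLatticeRep 2) β (fun k => x k - (R + 1)) (2 * R + 3) η
            (plane (Matrix.specialUnitaryGroup (Fin 2) ℂ) (fundamentalLatticeRep 2) q x) -
          kerE (Matrix.specialUnitaryGroup (Fin 2) ℂ) (fundamentalLatticeRep 2) β (fun k => x k - (R + 1)) (2 * R + 3) 1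
            (plane (Matrix.specialUnitaryGroup (Fin 2) ℂ) (fundamentalLatticeRep 2) q x)|) =
        (R : ℝ) ^ 4 / C₁ *
        |kerE (Matrix.specialUnitaryGroup (Fin 2) ℂ) (fundamentalLatticeRep 2) β (fun k => x k - (R + 1)) (2 * R + 3) η
            (plane (Matrix.specialUnitaryGroup (Fin 2) ℂ) (fundamentalLatticeRep 2) q x) -
          kerE (Matrix.specialUnitaryGroup (Fin 2) ℂ) (fundamentalLatticeRep 2) β (fun k => x k - (R + 1)) (2 * R + 3) 1
            (plane (Matrix.specialUnitaryGroup (Fin 2) ℂ) (fundamentalLatticeRep 2) q x)| := by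
      field_simp
    have hrhs : C₁' / C₁ * (A₂ + carrierCl (fundamentalLatticeRep 2) C_s 1 β R q x η) =
        C₁' / C₁ * A₂ + carrierCl (fundamentalLatticeRep 2) (C_s * C₁ / C₁') 1 β R q x η := by
      rw [carrierCl_eq_mul (fundamentalLatticeRep 2) C_s (C_s * C₁ / C₁') 1 β hCs.ne' R q x η]
      have : C_s / (C_s * C₁ / C₁') = C₁' / C₁ := by field_simp
      rw [this]; ring
    rw [hlhs, hrhs] at h1
    exact h1

/-- **(CW) ∧ (GD) ⇒ the registered (RM) body `ResponseMomentsOdd6SU2`** (tempered-d1's press-button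
`responseMomentsOdd6SU2_of_pureSplitCl_and_gaussianDomination` on the previous theorem): the measure side of «coldwall_pure» needs TWO stubs, not three.
[folklore] -/
theorem responseMomentsOdd6SU2_of_coldWallSplit_of_gaussianDomination
    (hCW : ∃ (C_s C₁ A₂ β₂ ℓ₂ : ℝ), 0 < C_s ∧ 0 < C₁ ∧ 0 ≤ A₂ ∧ 0 < ℓ₂ ∧
      ∀ β : ℝ, β₂ ≤ β → ∀ R : ℕ, 1 ≤ R → (R : ℝ) * Transport.uRec β ≤ ℓ₂ →
      ∀ (q : Fin 4 × Fin 4) (x : Fin 4 → ℤ), q.1 < q.2 → ∀ η : LGConfig 4 (Matrix.specialUnitaryGroup (Fin 2) ℂ),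
      (R : ℝ) ^ 4 / C₁ * |kerE (Matrix.specialUnitaryGroup (Fin 2) ℂ) (fundamentalLatticeRep 2) β (fun k => x k - (R + 1)) (2 * R + 3) η
          (plane (Matrix.specialUnitaryGroup (Fin 2) ℂ) (fundamentalLatticeRep 2) q x) -
        kerE (Matrix.specialUnitaryGroup (Fin 2) ℂ) (fundamentalLatticeRep 2) β (fun k => x k - (R + 1)) (2 * R + 3) 1
          (plane (Matrix.specialUnitaryGroup (Fin 2) ℂ) (fundamentalLatticeRep 2) q x)| ≤
        A₂ + carrierCl (fundamentalLatticeRep 2) C_s 1 β R q x η)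
    (hGD : GaussianDominationSU2) : ResponseMomentsOdd6SU2 :=
  responseMomentsOdd6SU2_of_pureSplitCl_and_gaussianDomination (pureSplitClSU2_of_coldWallSplit_of_gaussianDomination hCW hGD) hGD

end SU2

end Summit.QuantumFields.YangMills.Cruxes.UVSeamRec.ClassicalResponse

end
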